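import Summits.BirchSwinnertonDyer.BirchSwinnertonDyer.Theorems.AlignedTransportAtTwoMainConjectureOfRankZeroBSDAtTwoSexticNormRelationDescentAdjoinIAscent
import Summits.BirchSwinnertonDyer.BirchSwinnertonDyer.Theorems.AlignedTransportAtTwoMainConjectureOfRankZeroBSDAtTwoResolventMuUnconditional
import HarnessLib

/-!
# Route `AlignedTransportAtTwo`, crux C2 `MainConjectureOfRankZeroBSDAtTwo` (stmt-BirchSwinnertonDyer-22298):
# THE PFμ⁺ CARRIER `ℚ(W[2], √−1)` AND THE CM POINT FIELD `ℚ(β, √−1)` HAVE THE SAME `μ₂ = 0` STATEMENT — BOTH SIGNS OF `Δ_W`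

HONEST FRAMING. WIDTH-5 attached prover seat `bsd-line-att-p3` g34 on line `birth` of the lead `bsd-line-att-p2`; `--supports`
stmt-BirchSwinnertonDyer-22298, closes nothing; BSD is NOT proved; crux C2, its verdict «blocked-on `Rank1Residual.GreenbergMuConjectureIrreducible`»
and every registered stub untouched — in particular PFμ⁺ = `PointFieldMuCycAtTwo` («`μ₂ = 0` for every cyclotomic `ℤ₂`-extension of `ℚ(W[2], √−1)`»)
stays OPEN: this file re-prices its conclusion, it does not prove it. THEOREMS ONLY (no `def`, no named fact, no `sorry`).

WHAT. `W/ℚ` elliptic with no rational `2`-torsion abscissa and `Δ_W ∉ ℚ²`; `T = ℚ(W[2]) ⊆ ℚ̄`, `β_j` a `2`-torsion abscissa, `δ = 4δ₀` (`δ² = Δ_W`),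
`i² = −1`, `M = T ⊔ ℚ⟮i⟯ = ℚ(W[2], √−1)` (the PFμ⁺ carrier, typed exactly as in the registered stub) and `P_j = ℚ⟮β_j⟯ ⊔ ℚ⟮i⟯ = ℚ(β_j, √−1)` — a CM
sextic field (when `Δ_W > 0`: totally real cubic `ℚ(β_j)` with `√−1` adjoined). The point: **`M = P_j(δ)` is a QUADRATIC extension of the TOTALLY
COMPLEX field `P_j`**, so Iwasawa's `ℓ = 2` ascent needs no unit signatures and no narrow data (cell bsd-2adic's kernel form
`classicalMuVanishes_restrict_rat_of_sq_eq`, archimedean factor `1`/vacuous signatures), while the descent `M ⊇ P_j` is Iwasawa 1973 §3. Hence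

* §1 Galois bookkeeping in `ℚ̄`: `exists_add_mul_of_mem_sup_adjoin'` (elements of `E ⊔ ℚ⟮i⟯`), ★ `adjoin_xT_sup_adjoin_delta_eq_divisionField_two`
  (**`ℚ⟮β_j⟯ ⊔ ℚ⟮δ⟯ = ℚ(W[2])`**, sign-free, by degrees `3·2 = 6`), `I_not_mem_divisionField_two` (`i ∉ ℚ(W[2])` unless `−Δ_W ∈ ℚ²`),
  `delta_not_mem_adjoin_xT_sup_adjoin_I` (`δ ∉ ℚ(β_j, i)`).
* §2 ★★ `classicalMuVanishes_sup_adjoin_I_of_pointFieldCM` — `Δ_W, 2Δ_W, −2Δ_W, −Δ_W ∉ ℚ²`: **`μ₂ = 0` for every cyclotomic `ℤ₂`-extension of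
  `ℚ(β_j, √−1)` ⟹ `μ₂ = 0` for every cyclotomic `ℤ₂`-extension of `ℚ(W[2], √−1)`** (the PFμ⁺ conclusion for `W`), ONE `j`.
* The converse (finite descent), the equivalence «PFμ⁺'s conclusion for `W` ⟺ `μ₂(ℚ(β_j, √−1)^{cyc}) = 0`» and the forms on C2's binders are the
  sequel file `…PointFieldCarrierCMIff` (same seat).

References: [Iwasawa1973MuInvariants] Thm. 2/3, §3, §4; [Washington1997] §13.1, §13.3 Prop. 13.23; [SilvermanAEC2009] III.§1, VIII.§1; tree: att-p4 g29
`…SexticNormRelationDescentSignFreeAdjoinI` / `…AdjoinIAscent` (the `Δ_W < 0` `C₂`-step, proof pattern), cell bsd-2adic `ClassicalMuVanishesQuadraticAscentSqrt`,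
`ClassicalMuVanishesFiniteDescentNoGrowth`, att-p3 g34 `…ResolventMuUnconditional`.
-/

set_option linter.dupNamespace false
set_option autoImplicit false

noncomputable section

open scoped Classical NumberField

namespace Summit.BirchSwinnertonDyer.BirchSwinnertonDyer.Theorems.AlignedTransportAtTwoPointFieldCarrierCM

open NumberField Polynomial WeierstrassCurve IntermediateField Field
  Literature.NumberTheory.EllipticCurves Literature.NumberTheory.EllipticCurves.Greenberg1999
  Literature.NumberTheory.EllipticCurves.DokchitserDokchitser2012
  Literature.NumberTheory.EllipticCurves.ZpExtension Literature.NumberTheory.GaloisRepresentations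
  Literature.NumberTheory.IwasawaTheory Literature.NumberTheory.NumberFields
  Summit.BirchSwinnertonDyer.BirchSwinnertonDyer.Theorems.AlignedTransportAtTwoFineRoad.DivisionCubic
  Summit.BirchSwinnertonDyer.BirchSwinnertonDyer.Theorems.AlignedTransportAtTwoFineRoad.TowerImageDelta
  Summit.BirchSwinnertonDyer.BirchSwinnertonDyer.Theorems.AlignedTransportAtTwoCubicClosureParity
  Summit.BirchSwinnertonDyer.BirchSwinnertonDyer.Theorems.AlignedTransportAtTwoSexticTowerGrowth
  Summit.BirchSwinnertonDyer.BirchSwinnertonDyer.Theorems.AlignedTransportAtTwoSexticNormRelationDescent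
  Summit.BirchSwinnertonDyer.BirchSwinnertonDyer.Theorems.AlignedTransportAtTwoSexticNormRelationDescentSignFree
  Summit.BirchSwinnertonDyer.BirchSwinnertonDyer.Theorems.AlignedTransportAtTwoSexticNormRelationDescentSignFreeIff
  Summit.BirchSwinnertonDyer.BirchSwinnertonDyer.Theorems.AlignedTransportAtTwoSexticNormRelationDescentSignFreeOneRoot
  Summit.BirchSwinnertonDyer.BirchSwinnertonDyer.Theorems.AlignedTransportAtTwoSexticNormRelationDescentSignFreeAdjoinI
  Summit.BirchSwinnertonDyer.BirchSwinnertonDyer.Theorems.AlignedTransportAtTwoSexticNormRelationDescentAdjoinIAscent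
  Summit.BirchSwinnertonDyer.BirchSwinnertonDyer.Theorems.AlignedTransportAtTwoResolventMuUnconditional

/-- A totally complex number field has no ring morphism to `ℝ`. [folklore] -/
private theorem false_of_ringHom_real {K' : Type} [Field K'] [NumberField K'] [IsTotallyComplex K'] (ρ : K' →+* ℝ) : False := by
  have h : ComplexEmbedding.IsReal (Complex.ofRealHom.comp ρ) := by
    rw [ComplexEmbedding.isReal_iff]
    ext x
    simp [ComplexEmbedding.conjugate_coe_eq]
  exact IsTotallyComplex.complexEmbedding_not_isReal _ h

variable (W : WeierstrassCurve ℚ) [W.IsElliptic]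

/-! ## §1 Galois bookkeeping inside `ℚ̄` -/

omit [W.IsElliptic] in
/-- **Every element of `E ⊔ ℚ⟮i⟯` is `a + b·i` with `a, b ∈ E`** (`i² = −1`, `E` any intermediate field of `ℚ̄/ℚ`): att-p4 g29's
`exists_add_mul_of_mem_sup_adjoin` for `E = ℚ(W[2])`, verbatim for a general `E`. [cite: MilneFT2022, Ch. 3] -/
theorem exists_add_mul_of_mem_sup_adjoin' (E : IntermediateField ℚ (AlgebraicClosure ℚ)) {i : AlgebraicClosure ℚ} (hi : i ^ 2 = -1)
    {y : AlgebraicClosure ℚ} (hy : y ∈ E ⊔ IntermediateField.adjoin ℚ ({i} : Set (AlgebraicClosure ℚ))) :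
    ∃ a ∈ E, ∃ b ∈ E, y = a + b * i := by
  set Qi : IntermediateField ℚ (AlgebraicClosure ℚ) := IntermediateField.adjoin ℚ ({i} : Set (AlgebraicClosure ℚ)) with hQi
  have hint : IsIntegral ℚ i := by
    refine ⟨X ^ 2 + 1, monic_X_pow_add_C _ two_ne_zero, ?_⟩
    simp [hi]
  haveI : FiniteDimensional ℚ ↥Qi := IntermediateField.adjoin.finiteDimensional hint
  let S : Subalgebra ℚ (AlgebraicClosure ℚ) :=
    { carrier := {w | ∃ a ∈ E, ∃ b ∈ E, w = a + b * i}
      mul_mem' := by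
        rintro u v ⟨a, ha, b, hb, rfl⟩ ⟨c, hc, e, he, rfl⟩
        refine ⟨a * c - b * e, sub_mem (mul_mem ha hc) (mul_mem hb he), a * e + b * c, add_mem (mul_mem ha he) (mul_mem hb hc), ?_⟩
        linear_combination (b * e) * hi
      one_mem' := ⟨1, one_mem _, 0, zero_mem _, by ring⟩
      add_mem' := by
        rintro u v ⟨a, ha, b, hb, rfl⟩ ⟨c, hc, e, he, rfl⟩
        exact ⟨a + c, add_mem ha hc, b + e, add_mem hb he, by ring⟩
      zero_mem' := ⟨0, zero_mem _, 0, zero_mem _, by ring⟩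
      algebraMap_mem' := fun t ↦ ⟨algebraMap ℚ _ t, IntermediateField.algebraMap_mem E t, 0, zero_mem _, by ring⟩ }
  have hES : E.toSubalgebra ≤ S := fun w hw ↦ ⟨w, hw, 0, zero_mem _, by ring⟩
  have hiS : i ∈ S := ⟨0, zero_mem _, 1, one_mem _, by ring⟩
  have hQiS : Qi.toSubalgebra ≤ S := by
    rw [hQi, IntermediateField.adjoin_simple_toSubalgebra_of_isAlgebraic hint.isAlgebraic]
    exact Algebra.adjoin_le (Set.singleton_subset_iff.mpr hiS)
  have hK'S : (E ⊔ Qi).toSubalgebra ≤ S := by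
    haveI : Algebra.IsAlgebraic ℚ ↥Qi := Algebra.IsAlgebraic.of_finite ℚ ↥Qi
    rw [IntermediateField.sup_toSubalgebra_of_isAlgebraic_right]
    exact sup_le hES hQiS
  obtain ⟨a, ha, b, hb, h⟩ := hK'S hy
  exact ⟨a, ha, b, hb, h⟩

/-- `[ℚ(β_j) : ℚ] = 3` for a `2`-torsion abscissa of a curve with no rational `2`-torsion abscissa (model `ℚ⟮β_j⟯ ⊆ ℚ̄`).
[cite: SilvermanAEC2009, III.§1 and VIII.§1] -/
theorem finrank_adjoin_xT_model (ht : ∀ x : ℚ, ¬ HasRationalTwoTorsionX W x) (j : Fin 3) :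
    Module.finrank ℚ ↥ℚ⟮xT W two_ne_zero j⟯ = 3 := by
  have hirr := AlignedTransportAtTwoSeed.irr_two_of_forall_not_hasRationalTwoTorsionX W ht
  have hβ : aeval (xT W two_ne_zero j) W.twoTorsionPolynomial.toPoly = 0 :=
    (mem_rootSet_of_ne (twoTorsionPolynomial_toPoly_ne_zero W two_ne_zero)).mp (xT_mem_rootSet W two_ne_zero j)
  exact AddKatoTwo.finrank_adjoin_root_twoTorsionPolynomial_eq_three W hirr hβ

/-- ★ **`ℚ⟮β_j⟯ ⊔ ℚ⟮δ⟯ = ℚ(W[2])` inside `ℚ̄`, BOTH signs** (`W(ℚ)[2] = 0`, `Δ_W ∉ ℚ²`; `δ = 4δ₀`): `≤` as both generators lie in `T`; the compositum has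
degree divisible by `3 = [ℚ(β_j):ℚ]` and by `2 = [ℚ(δ):ℚ]` and dividing `[T:ℚ] = 6`. Sign-free, any-root form of att-p4 g28's `adjoin_delta_eq_top`.
[cite: SilvermanAEC2009, III.§1 and VIII.§1] [cite: DokchitserDokchitserMathZ2012, Theorem (1), proof (ℚ(E[2]) ⊃ ℚ(√Δ))] -/
theorem adjoin_xT_sup_adjoin_delta_eq_divisionField_two (ht : ∀ x : ℚ, ¬ HasRationalTwoTorsionX W x) (hsq : ¬ IsSquare W.Δ) (j : Fin 3) :
    ℚ⟮xT W two_ne_zero j⟯ ⊔ ℚ⟮4 * delta W two_ne_zero⟯ = W.divisionField 2 := by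
  set β : AlgebraicClosure ℚ := xT W two_ne_zero j with hβdef
  set δ : AlgebraicClosure ℚ := 4 * delta W two_ne_zero with hδdef
  have hβT : β ∈ W.divisionField 2 := xT_mem W j
  have hδT : δ ∈ W.divisionField 2 := (delta_mem_and_sq W).1
  have hδsq : δ ^ 2 = ((W.Δ : ℚ) : AlgebraicClosure ℚ) := (delta_mem_and_sq W).2
  have hle : ℚ⟮β⟯ ⊔ ℚ⟮δ⟯ ≤ W.divisionField 2 := sup_le (adjoin_simple_le_iff.mpr hβT) (adjoin_simple_le_iff.mpr hδT)
  have hβint : IsIntegral ℚ β := ((AlgebraicClosure.isAlgebraic ℚ).isAlgebraic β).isIntegral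
  have hδint : IsIntegral ℚ δ := ((AlgebraicClosure.isAlgebraic ℚ).isAlgebraic δ).isIntegral
  haveI : FiniteDimensional ℚ ↥ℚ⟮β⟯ := IntermediateField.adjoin.finiteDimensional hβint
  haveI : FiniteDimensional ℚ ↥ℚ⟮δ⟯ := IntermediateField.adjoin.finiteDimensional hδint
  haveI : FiniteDimensional ℚ ↥(ℚ⟮β⟯ ⊔ ℚ⟮δ⟯) := IntermediateField.finiteDimensional_sup ℚ⟮β⟯ ℚ⟮δ⟯
  have hF3 : Module.finrank ℚ ↥ℚ⟮β⟯ = 3 := finrank_adjoin_xT_model W ht j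
  have hK2 : Module.finrank ℚ ↥ℚ⟮δ⟯ = 2 := finrank_adjoin_eq_two_of_sq_eq hδsq hsq
  have hT6 : Module.finrank ℚ ↥(W.divisionField 2) = 6 := finrank_divisionField_two_eq_six W ht hsq
  have h3 : 3 ∣ Module.finrank ℚ ↥(ℚ⟮β⟯ ⊔ ℚ⟮δ⟯) := hF3 ▸ IntermediateField.finrank_dvd_of_le_right (le_sup_left : ℚ⟮β⟯ ≤ ℚ⟮β⟯ ⊔ ℚ⟮δ⟯)
  have h2 : 2 ∣ Module.finrank ℚ ↥(ℚ⟮β⟯ ⊔ ℚ⟮δ⟯) := hK2 ▸ IntermediateField.finrank_dvd_of_le_right (le_sup_right : ℚ⟮δ⟯ ≤ ℚ⟮β⟯ ⊔ ℚ⟮δ⟯)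
  have h6 : 6 ∣ Module.finrank ℚ ↥(ℚ⟮β⟯ ⊔ ℚ⟮δ⟯) := Nat.Coprime.mul_dvd_of_dvd_of_dvd (by norm_num : Nat.Coprime 2 3) h2 h3
  have hdvd : Module.finrank ℚ ↥(ℚ⟮β⟯ ⊔ ℚ⟮δ⟯) ∣ 6 := hT6 ▸ IntermediateField.finrank_dvd_of_le_right hle
  refine IntermediateField.eq_of_le_of_finrank_eq hle ?_
  exact (Nat.dvd_antisymm hdvd h6).trans hT6.symm

/-- **`√−1 ∉ ℚ(W[2])` unless `−Δ_W ∈ ℚ²`** (att-p4 g29's `forall_sq_ne_ratCast_divisionField_two` at `r = −1`: the only quadratic subfield of the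
`S₃`-field `ℚ(W[2])` is `ℚ(√Δ_W)`). [cite: SilvermanAEC2009, III.§1] -/
theorem I_not_mem_divisionField_two (ht : ∀ x : ℚ, ¬ HasRationalTwoTorsionX W x) (hsq : ¬ IsSquare W.Δ) (hnegΔ : ¬ IsSquare (-W.Δ))
    {i : AlgebraicClosure ℚ} (hi : i ^ 2 = -1) : i ∉ W.divisionField 2 := by
  intro hiT
  have hm1 : ¬ IsSquare (-1 : ℚ) := fun ⟨r, hr⟩ ↦ by nlinarith [mul_self_nonneg r]
  have hm1Δ : ¬ IsSquare (-1 * W.Δ) := by rwa [neg_one_mul]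
  refine forall_sq_ne_ratCast_divisionField_two W ht hsq (-1) hm1 hm1Δ ⟨i, hiT⟩ ?_
  apply Subtype.ext
  push_cast
  exact hi

/-- **`δ ∉ ℚ(β_j, √−1)`** (`W(ℚ)[2] = 0`, `Δ_W ∉ ℚ²`, `−Δ_W ∉ ℚ²`, `i² = −1`): writing `δ = a + b i` with `a, b ∈ ℚ(β_j)`, `b ≠ 0` would put `i` in `ℚ(W[2])`,
and `b = 0` would put the degree-`2` element `δ` in the cubic field `ℚ(β_j)`. [cite: SilvermanAEC2009, III.§1 and VIII.§1] -/
theorem delta_not_mem_adjoin_xT_sup_adjoin_I (ht : ∀ x : ℚ, ¬ HasRationalTwoTorsionX W x) (hsq : ¬ IsSquare W.Δ) (hnegΔ : ¬ IsSquare (-W.Δ))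
    {i : AlgebraicClosure ℚ} (hi : i ^ 2 = -1) (j : Fin 3) :
    4 * delta W two_ne_zero ∉ ℚ⟮xT W two_ne_zero j⟯ ⊔ IntermediateField.adjoin ℚ ({i} : Set (AlgebraicClosure ℚ)) := by
  intro hmem
  set β : AlgebraicClosure ℚ := xT W two_ne_zero j with hβdef
  set δ : AlgebraicClosure ℚ := 4 * delta W two_ne_zero with hδdef
  obtain ⟨a, ha, b, hb, hab⟩ := exists_add_mul_of_mem_sup_adjoin' ℚ⟮β⟯ hi hmem
  have hβT : ℚ⟮β⟯ ≤ W.divisionField 2 := adjoin_simple_le_iff.mpr (xT_mem W j)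
  by_cases hb0 : b = 0
  · -- `δ ∈ ℚ(β_j)`: a degree-`2` element in a cubic field
    rw [hb0, zero_mul, add_zero] at hab
    have hδF : δ ∈ ℚ⟮β⟯ := hab ▸ ha
    have hδint : IsIntegral ℚ δ := ((AlgebraicClosure.isAlgebraic ℚ).isAlgebraic δ).isIntegral
    have hβint : IsIntegral ℚ β := ((AlgebraicClosure.isAlgebraic ℚ).isAlgebraic β).isIntegral
    haveI : FiniteDimensional ℚ ↥ℚ⟮β⟯ := IntermediateField.adjoin.finiteDimensional hβint
    haveI : FiniteDimensional ℚ ↥ℚ⟮δ⟯ := IntermediateField.adjoin.finiteDimensional hδint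
    have hle : ℚ⟮δ⟯ ≤ ℚ⟮β⟯ := adjoin_simple_le_iff.mpr hδF
    have hdvd := IntermediateField.finrank_dvd_of_le_right hle
    rw [finrank_adjoin_eq_two_of_sq_eq (delta_mem_and_sq W).2 hsq, finrank_adjoin_xT_model W ht j] at hdvd
    omega
  · -- `b ≠ 0`: `i = (δ − a)/b ∈ ℚ(W[2])`
    apply I_not_mem_divisionField_two W ht hsq hnegΔ hi
    have haT : a ∈ W.divisionField 2 := hβT ha
    have hbT : b ∈ W.divisionField 2 := hβT hb
    have hi' : i = (δ - a) * b⁻¹ := by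
      rw [hab]; field_simp; ring
    rw [hi']
    exact mul_mem (sub_mem (delta_mem_and_sq W).1 haT) (inv_mem hbT)

/-! ## §2 The ascent `ℚ(β_j, √−1) → ℚ(W[2], √−1)`: quadratic over a totally complex base -/

set_option maxHeartbeats 800000 in
/-- ★★ **`μ₂(ℚ(β_j, √−1)^{cyc}) = 0 ⟹ μ₂(ℚ(W[2], √−1)^{cyc}) = 0` — the PFμ⁺ conclusion for `W` from the CM point field, BOTH signs.** `W/ℚ` elliptic, no
rational `2`-torsion abscissa, `Δ_W, 2Δ_W, −2Δ_W, −Δ_W ∉ ℚ²`, `i² = −1`, `j : Fin 3`: if `μ₂ = 0` (growth form) for every cyclotomic `ℤ₂`-extension of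
`P_j = ℚ⟮β_j⟯ ⊔ ℚ⟮i⟯`, then for every cyclotomic `ℤ₂`-extension of `M = ℚ(W[2]) ⊔ ℚ⟮i⟯`. `M = P_j(δ)` with `[M : P_j] = 2` (§1) and `P_j ∋ i` totally complex, so
cell bsd-2adic's kernel form of Iwasawa's `ℓ = 2` ascent applies with vacuous signature hypothesis; `M ∩ ℚ_∞ = ℚ` is att-p4 g29's
`surjective_gal_restrict_sup_adjoin_I`, `P_j ∩ ℚ_∞ = ℚ` follows (`√2 ∉ M ⊇ P_j`, degree-free criterion). [cite: Iwasawa1973MuInvariants, Thm. 2 and Thm. 3, §4]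
[cite: Washington1997, §13.1 and §13.3 Prop. 13.23] -/
theorem classicalMuVanishes_sup_adjoin_I_of_pointFieldCM (ht : ∀ x : ℚ, ¬ HasRationalTwoTorsionX W x) (hsq : ¬ IsSquare W.Δ)
    (h2Δ : ¬ IsSquare (2 * W.Δ)) (hm2Δ : ¬ IsSquare (-2 * W.Δ)) (hnegΔ : ¬ IsSquare (-W.Δ)) {i : AlgebraicClosure ℚ} (hi : i ^ 2 = -1)
    (j : Fin 3)
    (hP : ∀ κP : ZpExtension ↥(ℚ⟮xT W two_ne_zero j⟯ ⊔ IntermediateField.adjoin ℚ ({i} : Set (AlgebraicClosure ℚ))) 2,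
      κP.IsCyclotomic → ClassicalMuVanishes κP) :
    ∀ κL : ZpExtension ↥(W.divisionField 2 ⊔ IntermediateField.adjoin ℚ ({i} : Set (AlgebraicClosure ℚ))) 2,
      κL.IsCyclotomic → ClassicalMuVanishes κL := by
  haveI : Fact (Nat.Prime 2) := ⟨Nat.prime_two⟩
  set Qi : IntermediateField ℚ (AlgebraicClosure ℚ) := IntermediateField.adjoin ℚ ({i} : Set (AlgebraicClosure ℚ)) with hQi
  set β : AlgebraicClosure ℚ := xT W two_ne_zero j with hβdef
  set δ : AlgebraicClosure ℚ := 4 * delta W two_ne_zero with hδdef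
  set P : IntermediateField ℚ (AlgebraicClosure ℚ) := ℚ⟮β⟯ ⊔ Qi with hPdef
  set M : IntermediateField ℚ (AlgebraicClosure ℚ) := W.divisionField 2 ⊔ Qi with hMdef
  have hint : IsIntegral ℚ i := by
    refine ⟨X ^ 2 + 1, monic_X_pow_add_C _ two_ne_zero, ?_⟩
    simp [hi]
  have hβint : IsIntegral ℚ β := ((AlgebraicClosure.isAlgebraic ℚ).isAlgebraic β).isIntegral
  haveI : FiniteDimensional ℚ ↥Qi := IntermediateField.adjoin.finiteDimensional hint
  haveI : FiniteDimensional ℚ ↥ℚ⟮β⟯ := IntermediateField.adjoin.finiteDimensional hβint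
  haveI : NumberField ↥(W.divisionField 2) := NumberField.mk
  haveI : FiniteDimensional ℚ ↥M := IntermediateField.finiteDimensional_sup (W.divisionField 2) Qi
  haveI hNF : NumberField ↥M := NumberField.of_module_finite ℚ _
  haveI : FiniteDimensional ℚ ↥P := IntermediateField.finiteDimensional_sup ℚ⟮β⟯ Qi
  haveI hNFP : NumberField ↥P := NumberField.of_module_finite ℚ _
  -- inclusions and distinguished elements
  have hβT : ℚ⟮β⟯ ≤ W.divisionField 2 := adjoin_simple_le_iff.mpr (xT_mem W j)
  have hPM : P ≤ M := sup_le_sup_right hβT Qi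
  have hiQi : i ∈ Qi := IntermediateField.mem_adjoin_simple_self ℚ i
  have hiP : i ∈ P := (le_sup_right : Qi ≤ P) hiQi
  have hiM : i ∈ M := (le_sup_right : Qi ≤ M) hiQi
  have hδT : δ ∈ W.divisionField 2 := (delta_mem_and_sq W).1
  have hδM : δ ∈ M := (le_sup_left : W.divisionField 2 ≤ M) hδT
  have hδsq : δ ^ 2 = ((W.Δ : ℚ) : AlgebraicClosure ℚ) := (delta_mem_and_sq W).2
  have hδP : δ ∉ P := delta_not_mem_adjoin_xT_sup_adjoin_I W ht hsq hnegΔ hi j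
  -- both fields are totally complex (they contain `i`)
  haveI : IsTotallyComplex ↥M := ⟨FineSelmerUpstairs.isComplex_of_mem_sq_eq_neg_one i hi _ hiM⟩
  haveI : IsTotallyComplex ↥P := ⟨FineSelmerUpstairs.isComplex_of_mem_sq_eq_neg_one i hi _ hiP⟩
  haveI : Subsingleton (↥P →+* ℝ) := ⟨fun φ _ ↦ (false_of_ringHom_real φ).elim⟩
  letI : Algebra ↥P ↥M := (IntermediateField.inclusion hPM).toRingHom.toAlgebra
  haveI : IsScalarTower ℚ ↥P ↥M := IsScalarTower.of_algebraMap_eq fun _ ↦ rfl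
  -- the generator `x = den(Δ)·δ ∈ 𝓞_M`, `x² = num(Δ)·den(Δ) ∈ ℤ`
  set N : ℤ := W.Δ.num * W.Δ.den with hNdef
  have hΔ0 : W.Δ ≠ 0 := W.isUnit_Δ.ne_zero
  have hN0 : N ≠ 0 := mul_ne_zero (Rat.num_ne_zero.mpr hΔ0) (by exact_mod_cast W.Δ.den_nz)
  have hxsqQ : ((W.Δ.den : ℚ) * 1) ^ 2 * W.Δ = (N : ℚ) := by
    rw [hNdef, mul_one]
    have h := Rat.mul_den_eq_num W.Δ
    push_cast
    calc ((W.Δ.den : ℚ)) ^ 2 * W.Δ = (W.Δ.den : ℚ) * (W.Δ * W.Δ.den) := by ring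
      _ = (W.Δ.den : ℚ) * W.Δ.num := by rw [h]
      _ = W.Δ.num * W.Δ.den := by ring
  have hxsq : ((W.Δ.den : AlgebraicClosure ℚ) * δ) ^ 2 = ((N : ℚ) : AlgebraicClosure ℚ) := by
    rw [mul_pow, hδsq, ← hxsqQ]
    push_cast
    ring
  have hxint : IsIntegral ℤ ((W.Δ.den : AlgebraicClosure ℚ) * δ) := by
    refine ⟨X ^ 2 - C N, monic_X_pow_sub_C N two_ne_zero, ?_⟩
    simp only [eval₂_sub, eval₂_X_pow, eval₂_C, hxsq]
    simp
  have hxM : (W.Δ.den : AlgebraicClosure ℚ) * δ ∈ M := mul_mem (IntermediateField.natCast_mem M W.Δ.den) hδM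
  set x : 𝓞 ↥M := ⟨⟨(W.Δ.den : AlgebraicClosure ℚ) * δ, hxM⟩,
    (isIntegral_algHom_iff (IsScalarTower.toAlgHom ℤ ↥M (AlgebraicClosure ℚ)) Subtype.val_injective).mp hxint⟩ with hxdef
  have hm : ((N : 𝓞 ↥P)) ≠ 0 := by
    intro h0
    exact hN0 (Int.cast_eq_zero.mp h0)
  have hx : x ^ 2 = algebraMap (𝓞 ↥P) (𝓞 ↥M) (N : 𝓞 ↥P) := by
    apply RingOfIntegers.ext
    apply Subtype.ext
    change ((W.Δ.den : AlgebraicClosure ℚ) * δ) ^ 2 =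
      (((algebraMap (𝓞 ↥P) (𝓞 ↥M) (N : 𝓞 ↥P) : 𝓞 ↥M) : ↥M) : AlgebraicClosure ℚ)
    rw [hxsq, map_intCast]
    push_cast
    rfl
  -- `M = P[x]`: `M = T ⊔ ℚ⟮i⟯`, `T = ℚ⟮β⟯ ⊔ ℚ⟮δ⟯`, and `β, i ∈ P`, `δ = x/den`
  have hgen : Algebra.adjoin ↥P {((x : 𝓞 ↥M) : ↥M)} = ⊤ := by
    set A : Subalgebra ↥P ↥M := Algebra.adjoin ↥P {((x : 𝓞 ↥M) : ↥M)} with hA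
    let S : Subalgebra ℚ (AlgebraicClosure ℚ) :=
      { carrier := {w | ∃ hw : w ∈ M, (⟨w, hw⟩ : ↥M) ∈ A}
        mul_mem' := by
          rintro a b ⟨ha, ha'⟩ ⟨hb, hb'⟩
          exact ⟨mul_mem ha hb, by
            have e : (⟨a * b, mul_mem ha hb⟩ : ↥M) = ⟨a, ha⟩ * ⟨b, hb⟩ := rfl
            rw [e]; exact A.mul_mem ha' hb'⟩
        one_mem' := ⟨one_mem _, by
          have e : (⟨1, one_mem _⟩ : ↥M) = 1 := rfl
          rw [e]; exact A.one_mem⟩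
        add_mem' := by
          rintro a b ⟨ha, ha'⟩ ⟨hb, hb'⟩
          exact ⟨add_mem ha hb, by
            have e : (⟨a + b, add_mem ha hb⟩ : ↥M) = ⟨a, ha⟩ + ⟨b, hb⟩ := rfl
            rw [e]; exact A.add_mem ha' hb'⟩
        zero_mem' := ⟨zero_mem _, by
          have e : (⟨0, zero_mem _⟩ : ↥M) = 0 := rfl
          rw [e]; exact A.zero_mem⟩
        algebraMap_mem' := fun t ↦ ⟨IntermediateField.algebraMap_mem M t, A.algebraMap_mem (algebraMap ℚ ↥P t)⟩ }
    have hPS : ∀ w (hw : w ∈ P), w ∈ S := fun w hw ↦ ⟨hPM hw, by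
      have e : (⟨w, hPM hw⟩ : ↥M) = algebraMap ↥P ↥M ⟨w, hw⟩ := rfl
      rw [e]; exact A.algebraMap_mem _⟩
    have hxS : (W.Δ.den : AlgebraicClosure ℚ) * δ ∈ S := ⟨hxM, Algebra.subset_adjoin (Set.mem_singleton _)⟩
    have hδS : δ ∈ S := by
      have hd0 : ((W.Δ.den : ℚ) : AlgebraicClosure ℚ) ≠ 0 := by exact_mod_cast W.Δ.den_nz
      have e : δ = ((W.Δ.den : ℚ)⁻¹) • ((W.Δ.den : AlgebraicClosure ℚ) * δ) := by
        rw [Algebra.smul_def, map_inv₀]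
        push_cast
        field_simp
      rw [e]
      exact S.smul_mem hxS _
    -- `ℚ⟮β⟯ ≤ S`, `ℚ⟮δ⟯ ≤ S`, `ℚ⟮i⟯ ≤ S`
    have hδint : IsIntegral ℚ δ := ((AlgebraicClosure.isAlgebraic ℚ).isAlgebraic δ).isIntegral
    have hQβS : (ℚ⟮β⟯).toSubalgebra ≤ S := fun w hw ↦ hPS w ((le_sup_left : ℚ⟮β⟯ ≤ P) hw)
    have hQδS : (ℚ⟮δ⟯).toSubalgebra ≤ S := by
      rw [IntermediateField.adjoin_simple_toSubalgebra_of_isAlgebraic hδint.isAlgebraic]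
      exact Algebra.adjoin_le (Set.singleton_subset_iff.mpr hδS)
    have hQiS : Qi.toSubalgebra ≤ S := fun w hw ↦ hPS w ((le_sup_right : Qi ≤ P) hw)
    have hTS : (W.divisionField 2).toSubalgebra ≤ S := by
      rw [← adjoin_xT_sup_adjoin_delta_eq_divisionField_two W ht hsq j]
      haveI : FiniteDimensional ℚ ↥ℚ⟮δ⟯ := IntermediateField.adjoin.finiteDimensional hδint
      haveI : Algebra.IsAlgebraic ℚ ↥ℚ⟮δ⟯ := Algebra.IsAlgebraic.of_finite ℚ _
      rw [IntermediateField.sup_toSubalgebra_of_isAlgebraic_right]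
      exact sup_le hQβS hQδS
    have hMS : M.toSubalgebra ≤ S := by
      haveI : Algebra.IsAlgebraic ℚ ↥Qi := Algebra.IsAlgebraic.of_finite ℚ ↥Qi
      rw [hMdef, IntermediateField.sup_toSubalgebra_of_isAlgebraic_right]
      exact sup_le hTS hQiS
    rw [eq_top_iff]
    rintro ⟨w, hw⟩ -
    obtain ⟨hw', h⟩ := hMS hw
    exact h
  -- `[M : P] = 2`
  have hdeg : Module.finrank ↥P ↥M = 2 := by
    haveI : FiniteDimensional ↥P ↥M := Module.Finite.of_restrictScalars_finite ℚ ↥P ↥M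
    set y : ↥M := ((x : 𝓞 ↥M) : ↥M) with hy
    have hyint : IsIntegral ↥P y := IsIntegral.of_finite _ y
    have htop : (↥P)⟮y⟯ = ⊤ := by
      apply IntermediateField.toSubalgebra_injective
      rw [IntermediateField.adjoin_simple_toSubalgebra_of_isAlgebraic hyint.isAlgebraic, hgen, IntermediateField.top_toSubalgebra]
    have hfin : Module.finrank ↥P ↥M = (minpoly ↥P y).natDegree := by
      rw [← IntermediateField.adjoin.finrank hyint, htop, IntermediateField.finrank_top']
    have hy2 : y ^ 2 = algebraMap ↥P ↥M (N : ↥P) := by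
      apply Subtype.ext
      change ((W.Δ.den : AlgebraicClosure ℚ) * δ) ^ 2 = ((algebraMap ↥P ↥M (N : ↥P) : ↥M) : AlgebraicClosure ℚ)
      rw [hxsq, map_intCast]
      push_cast
      rfl
    have hle2 : (minpoly ↥P y).natDegree ≤ 2 := by
      have hp : (X ^ 2 - C (N : ↥P) : (↥P)[X]) ≠ 0 := X_pow_sub_C_ne_zero two_pos _
      have hroot : aeval y (X ^ 2 - C (N : ↥P) : (↥P)[X]) = 0 := by simp [hy2]
      have h := natDegree_le_natDegree (minpoly.degree_le_of_ne_zero ↥P y hp hroot)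
      rwa [natDegree_X_pow_sub_C] at h
    have hne : Module.finrank ↥P ↥M ≠ 1 := by
      intro h1
      have hbt : (⊥ : IntermediateField ↥P ↥M) = ⊤ := IntermediateField.bot_eq_top_iff_finrank_eq_one.mpr h1
      have hyb : y ∈ (⊥ : IntermediateField ↥P ↥M) := by rw [hbt]; trivial
      obtain ⟨t, ht'⟩ := IntermediateField.mem_bot.mp hyb
      apply hδP
      have htv : (t : AlgebraicClosure ℚ) = (W.Δ.den : AlgebraicClosure ℚ) * δ := by
        have h := congrArg (fun z : ↥M ↦ (z : AlgebraicClosure ℚ)) ht'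
        exact h
      have hd0 : (W.Δ.den : AlgebraicClosure ℚ) ≠ 0 := by exact_mod_cast W.Δ.den_nz
      have e : δ = (t : AlgebraicClosure ℚ) * (W.Δ.den : AlgebraicClosure ℚ)⁻¹ := by
        rw [htv]; field_simp
      rw [e]
      exact mul_mem t.2 (inv_mem (IntermediateField.natCast_mem P W.Δ.den))
    have hpos : 0 < (minpoly ↥P y).natDegree := minpoly.natDegree_pos hyint
    omega
  -- the cyclotomic tower of `ℚ` restricted to both fields, and the ascent
  obtain ⟨κ, hκ⟩ := exists_cyclotomicZpExtension_holds ℚ 2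
  have hM2 : ∀ z : ↥M, z ^ 2 ≠ 2 := forall_sq_ne_two_sup_adjoin_I W ht hsq h2Δ hm2Δ hi
  have hP2 : ∀ z : ↥P, z ^ 2 ≠ 2 := fun z hz ↦ hM2 ⟨(z : AlgebraicClosure ℚ), hPM z.2⟩ (by
    apply Subtype.ext
    have := congrArg (fun t : ↥P ↦ (t : AlgebraicClosure ℚ)) hz
    push_cast at this ⊢
    exact this)
  have hK : Function.Surjective (κ.toContinuousMonoidHom.comp (absGaloisRestrict ℚ ↥P)) :=
    surjective_comp_absGaloisRestrict_of_forall_sq_ne_two' κ ↥P hκ hP2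
  have hK' : Function.Surjective (κ.toContinuousMonoidHom.comp (absGaloisRestrict ℚ ↥M)) :=
    @surjective_gal_restrict_sup_adjoin_I W _ ht hsq h2Δ hm2Δ i hi κ hκ hNF
  have h1 : ClassicalMuVanishes (κ.restrict ↥P hK) := hP _ (isCyclotomic_restrict κ hκ _ hK)
  have h2 : ClassicalMuVanishes (κ.restrict ↥M hK') :=
    classicalMuVanishes_restrict_rat_of_sq_eq κ hκ ↥P ↥M hdeg hm hx hgen hK hK' h1
  intro κL hκL
  exact (classicalMuVanishes_iff_of_isCyclotomic _ _ (isCyclotomic_restrict κ hκ _ hK') hκL).mp h2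

end Summit.BirchSwinnertonDyer.BirchSwinnertonDyer.Theorems.AlignedTransportAtTwoPointFieldCarrierCM

end
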